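/-
Copyright (c) 2026 the pub-hodgecm-mathlib formalisation cell (harness21).  Prover seat hodgecm-mathlib-F0P2-p09 (g3) on chair-VALVE loan to section S6 of the R90-TF
programme (S6 dealer R90-C14-plan (g2) CARD FIN-2 «J4a-ϖ» 2026-09-05T03:19:38Z; spec K2Liu-p05 (g9) `FIN-CENSUS.md` c477b047 §(G1)); crux H413 (`stmt-HodgeConjecture-24833`).
THEOREMS ONLY (no `def`, no `instance`, no notation, no named-fact hypothesis, no `sorry`).
-/
import Literature.NumberTheory.Automorphic.UnitaryLatticeTreeDiagonalFixedBounded   -- ★ J4a `single_mul_mul_apply_mem_of_map_diagonal_le`, and (via it) ★ J4b `finite_of_forall_scaleLattice_le_and_le`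
import HarnessLib

/-!
# R90 · S6 — FIN-2 «J4a-ϖ», FILE A: FIXED VERTICES OF A REGULAR DIAGONAL ELEMENT ARE DEPTH-BOUNDED — FOR A DIAGONAL FORM WITH ENTRIES OF VALUATION IN `[|ϖ|, 1]`
# (`Theorems/R90S6DiagonalFixedBoundedPi.lean`)

Cell `hodgecm-mathlib`, crux H413 (`stmt-HodgeConjecture-24833`), route of record `HCCMUnconditional`; programme R90-TF, section S6 (base `R90-C14`); S6 dealer R90-C14-plan (g2)
CARD FIN-2 03:19:38Z («J4a with `hd : ∀ i, v (d i) = 1` WEAKENED to `v ϖ ≤ v (d i) ∧ v (d i) ≤ 1`»); spec = K2Liu-p05 (g9)'s «FIN» census §(G1); consumer = FILE B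
`R90S6FlickerLiteralFixFinite` (the finiteness letters `hfin₀ᵢ hfin₁ᵢ horbᵢ` of typ1's (E1) sheet v2.3 for Flicker's `t_ϖ`-literals, whose eigenframe `D_ϖ h` has the NON-unimodular Gram
matrix `diag(−2ϖ, 1, 2ϖ)`, ★ `Flicker1998.gram_flickerFrame_pi`); helper lane `--supports stmt-HodgeConjecture-24833 --as helper`.

THE MATHEMATICS — ★ J4a (`UnitaryLatticeTreeDiagonalFixedBounded`) re-walked with the duality bounds shifted by ONE power of `ϖ`.  Form `H = diag(d)` with `|ϖ| ≤ |d_i| ≤ 1`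
(so `det H ≠ 0`), element `T = diag(s)` with integral pairwise distinct entries, `δ_i = Π_{j ≠ i}(s_i − s_j)`, `δ ≠ 0` with `|δ| ≤ |δ_i|`.
* §1 (J4a §2 shifted) `diagFixedPi_v_mul_mul_apply_le_one`: if `T·M ⊆ M` and `M ≤ M^♯` then `|ϖ·δ_i·x_i| ≤ 1` for `x ∈ M` — J4a's Lagrange vector `δ_i x_i e_i ∈ M` (★
  `single_mul_mul_apply_mem_of_map_diagonal_le`, d-free) pairs with `x` to `σ(δ_i x_i)·d_i·x_i` (★ `pairing_diagonal_single_left`), so `|δ_i x_i|·|d_i|·|x_i| ≤ 1`; with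
  `|ϖ| ≤ |d_i|`: `(|ϖ|·|δ_i x_i|)² ≤ (|ϖ||δ_i|)·(|d_i||δ_i x_i||x_i|) ≤ 1`.  Hence `diagFixedPi_le_scaleLattice_inv`: **`M ≤ (ϖδ)⁻¹·L₀`**.
* §2 (J4a §3, needs only `|d_i| ≤ 1`) `diagFixedPi_scaleLattice_le_dualLatt`: `δ′·L₀ ≤ (δ′⁻¹·L₀)^♯` for any `δ′ ≠ 0`; with `ϖ·M^♯ ≤ M` for vertex lattices (★
  `scaleLattice_dualLatt_le_of_isVertexLattice`, needs `det H` a unit of `K`, i.e. `d_i ≠ 0`): `diagFixedPi_scaleLattice_mul_le`: **`ϖ·δ′·L₀ ≤ M`** at `δ′ = ϖδ`.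
* §3 every `T`-fixed vertex lies in the interval **`[ϖ²δ·L₀, (ϖδ)⁻¹·L₀]`** (`diagFixedPi_interval`, `diagFixedPi_setOf_latticeGraphIso_eq_subset_interval`), finite by ★ J4b for a finite
  residue field: HEAD **`diagFixedPi_finite_setOf_latticeGraphIso_diagonal_eq`** — ★ J4a `finite_setOf_latticeGraphIso_diagonal_eq` :223 binder for binder with `hd` weakened.
[Kottwitz1986BaseChangeUnits, §1 pp. 240–241] [Serre1980Trees, II.1.1] [BruhatTits1972, §10] [Jacobowitz1962, §4].
HONEST LABEL: elementary lattice algebra over ★ organs; count-neutral plumbing of the (E1)∕(E2) finiteness letters; closes no socket.  HC_CM is proved only modulo the 7 printed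
citations (2 remaining named inputs: hLiu418 = `stmt-HodgeConjecture-24832`, h413 = `stmt-HodgeConjecture-24833`) until rung 0 closes.

## References
* [Kottwitz1986BaseChangeUnits] R. E. Kottwitz, *Base change for unit elements of Hecke algebras*, Compositio Math. 60 (1986) 237–250: §1 pp. 240–241 (orbital integrals of unit elements as counts of fixed lattices, `𝒪[γ]`-modules, finitely many).
* [Serre1980Trees] J.-P. Serre, *Trees* (1980): Ch. II §1.1 (lattices stable under a split semisimple element lie in a bounded strip of its apartment).
* [BruhatTits1972] F. Bruhat, J. Tits, *Groupes réductifs sur un corps local I*, Publ. Math. IHÉS 41 (1972): §10.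
* [Jacobowitz1962] R. Jacobowitz, *Hermitian forms over local fields*, Amer. J. Math. 84 (1962) 441–465: §4 (dual lattices).
-/

set_option autoImplicit false
-- the mandated namespace repeats the single-problem summit's segment (`HodgeConjecture.HodgeConjecture`)
set_option linter.dupNamespace false

noncomputable section

open scoped Valued WithZero Matrix MatrixGroups

namespace Summit.HodgeConjecture.HodgeConjecture.R90.S6

open Literature.NumberTheory.Automorphic Literature.NumberTheory.Automorphic.HermitianLattice Literature.NumberTheory.Automorphic.UnitaryLatticeTree

variable {K : Type*} [Field K] [Valued K ℤᵐ⁰]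

/-- `a·a ≤ 1 ⇒ a ≤ 1` in the value group (file-local copy of ★ J4a's private helper). [folklore] -/
private theorem diagFixedPi_le_one_of_mul_self_le_one {a : ℤᵐ⁰} (h : a * a ≤ 1) : a ≤ 1 := by
  rcases le_or_gt a 1 with ha | ha
  · exact ha
  · exact absurd h (not_le.2 (lt_of_lt_of_le ha (le_mul_of_one_le_right' ha.le)))

/-- `det (diag d) ≠ 0`, indeed a unit of `K`, when `|ϖ| ≤ |d_i|` and `ϖ ≠ 0`. [folklore] -/
private theorem diagFixedPi_isUnit_det_diagonal {ϖ : K} (hϖ0 : ϖ ≠ 0) {d : Fin 3 → K} (hd : ∀ i, Valued.v ϖ ≤ Valued.v (d i) ∧ Valued.v (d i) ≤ 1) :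
    IsUnit (Matrix.diagonal d).det := by
  rw [Matrix.det_diagonal, isUnit_iff_ne_zero]
  refine Finset.prod_ne_zero_iff.2 (fun i _ h0 => ?_)
  have h := (hd i).1
  rw [h0, map_zero, le_zero_iff] at h
  exact hϖ0 ((Valuation.zero_iff _).1 h)

/-! ## §1 The upper bound `M ≤ (ϖδ)⁻¹·L₀` from `M ≤ M^♯` (J4a §2 shifted by one power of `ϖ`) -/

/-- **THE SHIFTED UPPER ESTIMATE**: for `H = diag(d)` with `|ϖ| ≤ |d_i| ≤ 1`, `T = diag(s)` integral, `M` `T`-stable with `M ≤ M^♯`: `|ϖ·δ_i·x_i| ≤ 1` for every `x ∈ M`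
(`δ_i = (s_i − s_j)(s_i − s_k)`); the pairing of `δ_i x_i e_i ∈ M` with `x` is `σ(δ_i x_i)·d_i·x_i`. [cite: Kottwitz1986BaseChangeUnits, §1 pp. 240–241] [cite: Serre1980Trees, II.1.1] -/
theorem diagFixedPi_v_mul_mul_apply_le_one {σ : K →+* K} (hvσ : ∀ a, Valued.v (σ a) = Valued.v a) {ϖ : K} (hϖ1 : Valued.v ϖ ≤ 1) {d : Fin 3 → K}
    (hd : ∀ i, Valued.v ϖ ≤ Valued.v (d i) ∧ Valued.v (d i) ≤ 1) {s : Fin 3 → K} (hs : ∀ l, Valued.v (s l) ≤ 1)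
    {M : Submodule 𝒪[K] (Fin 3 → K)} (hSM : M.map ((Matrix.toLin' (Matrix.diagonal s)).restrictScalars 𝒪[K]) ≤ M) (hMd : M ≤ dualLatt σ (Matrix.diagonal d) M)
    {i j k : Fin 3} (hij : i ≠ j) (hik : i ≠ k) (hjk : j ≠ k) {x : Fin 3 → K} (hx : x ∈ M) :
    Valued.v (ϖ * ((s i - s j) * (s i - s k) * x i)) ≤ 1 := by
  have hy := single_mul_mul_apply_mem_of_map_diagonal_le hs hSM hij hik hjk hx
  have hpair := (mem_dualLatt σ (Matrix.diagonal d) M x).1 (hMd hx) _ hy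
  rw [pairing_diagonal_single_left, map_mul, map_mul, hvσ, map_mul] at hpair
  -- `hpair : |δ_i| |x_i| |d_i| |x_i| ≤ 1`
  have hδ : Valued.v ((s i - s j) * (s i - s k)) ≤ 1 := by
    rw [map_mul]
    have h1 : Valued.v (s i - s j) ≤ 1 := (Valuation.map_sub _ _ _).trans (max_le (hs i) (hs j))
    have h2 : Valued.v (s i - s k) ≤ 1 := (Valuation.map_sub _ _ _).trans (max_le (hs i) (hs k))
    exact mul_le_one' h1 h2
  have h1 : Valued.v ϖ * Valued.v ((s i - s j) * (s i - s k)) ≤ 1 := mul_le_one' hϖ1 hδ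
  refine diagFixedPi_le_one_of_mul_self_le_one ?_
  rw [map_mul, map_mul]
  calc Valued.v ϖ * (Valued.v ((s i - s j) * (s i - s k)) * Valued.v (x i)) * (Valued.v ϖ * (Valued.v ((s i - s j) * (s i - s k)) * Valued.v (x i)))
      = (Valued.v ϖ * Valued.v ((s i - s j) * (s i - s k))) *
          (Valued.v ϖ * (Valued.v ((s i - s j) * (s i - s k)) * Valued.v (x i) * Valued.v (x i))) := by ac_rfl
    _ ≤ 1 * (Valued.v (d i) * (Valued.v ((s i - s j) * (s i - s k)) * Valued.v (x i) * Valued.v (x i))) :=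
          mul_le_mul' h1 (mul_le_mul' (hd i).1 le_rfl)
    _ = Valued.v ((s i - s j) * (s i - s k)) * Valued.v (x i) * Valued.v (d i) * Valued.v (x i) := by rw [one_mul]; ac_rfl
    _ ≤ 1 := hpair

/-- **`M ≤ (ϖδ)⁻¹·L₀`** under the hypotheses of `diagFixedPi_v_mul_mul_apply_le_one`, for any `δ ≠ 0` with `|δ| ≤ |(s_i − s_j)(s_i − s_k)|` for all orderings.
[cite: Kottwitz1986BaseChangeUnits, §1 pp. 240–241] [cite: Serre1980Trees, II.1.1] -/
theorem diagFixedPi_le_scaleLattice_inv {σ : K →+* K} (hvσ : ∀ a, Valued.v (σ a) = Valued.v a) {ϖ : K} (hϖ0 : ϖ ≠ 0) (hϖ1 : Valued.v ϖ ≤ 1) {d : Fin 3 → K}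
    (hd : ∀ i, Valued.v ϖ ≤ Valued.v (d i) ∧ Valued.v (d i) ≤ 1) {s : Fin 3 → K} (hs : ∀ l, Valued.v (s l) ≤ 1) {δ : K} (hδ0 : δ ≠ 0)
    (hδ : ∀ i j k : Fin 3, i ≠ j → i ≠ k → j ≠ k → Valued.v δ ≤ Valued.v ((s i - s j) * (s i - s k)))
    {M : Submodule 𝒪[K] (Fin 3 → K)} (hSM : M.map ((Matrix.toLin' (Matrix.diagonal s)).restrictScalars 𝒪[K]) ≤ M) (hMd : M ≤ dualLatt σ (Matrix.diagonal d) M) :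
    M ≤ scaleLattice (ϖ * δ)⁻¹ (stdLattice K 3) := by
  intro x hx
  rw [mem_scaleLattice_stdLattice_iff (inv_ne_zero (mul_ne_zero hϖ0 hδ0))]
  intro i
  obtain ⟨j, k, hij, hik, hjk⟩ : ∃ j k : Fin 3, i ≠ j ∧ i ≠ k ∧ j ≠ k := by
    fin_cases i
    · exact ⟨1, 2, by decide, by decide, by decide⟩
    · exact ⟨0, 2, by decide, by decide, by decide⟩
    · exact ⟨0, 1, by decide, by decide, by decide⟩
  have h := diagFixedPi_v_mul_mul_apply_le_one hvσ hϖ1 hd hs hSM hMd hij hik hjk hx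
  have hvδ : Valued.v (ϖ * δ) ≠ 0 := (Valuation.ne_zero_iff _).2 (mul_ne_zero hϖ0 hδ0)
  have key : Valued.v (ϖ * δ) * Valued.v (x i) ≤ 1 :=
    calc Valued.v (ϖ * δ) * Valued.v (x i) = Valued.v ϖ * (Valued.v δ * Valued.v (x i)) := by rw [map_mul, mul_assoc]
      _ ≤ Valued.v ϖ * (Valued.v ((s i - s j) * (s i - s k)) * Valued.v (x i)) := mul_le_mul' le_rfl (mul_le_mul' (hδ i j k hij hik hjk) le_rfl)
      _ = Valued.v (ϖ * ((s i - s j) * (s i - s k) * x i)) := by rw [← map_mul, ← map_mul]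
      _ ≤ 1 := h
  rw [map_inv₀]
  calc Valued.v (x i) = (Valued.v (ϖ * δ))⁻¹ * (Valued.v (ϖ * δ) * Valued.v (x i)) := by rw [← mul_assoc, inv_mul_cancel₀ hvδ, one_mul]
    _ ≤ (Valued.v (ϖ * δ))⁻¹ * 1 := mul_le_mul' le_rfl key
    _ = (Valued.v (ϖ * δ))⁻¹ := mul_one _

/-! ## §2 The lower bound `ϖ·δ′·L₀ ≤ M` from `ϖ·M^♯ ≤ M` (J4a §3 with `|d_i| ≤ 1` only) -/

/-- **`δ′·L₀ ≤ (δ′⁻¹·L₀)^♯ ≤ M^♯`** for a diagonal form with INTEGRAL entries: if `M ≤ δ′⁻¹·L₀` then every `y` with `|y_i| ≤ |δ′|` pairs integrally with `M`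
(`|⟨x, y⟩| ≤ max_i |x_i|·|d_i|·|y_i| ≤ |δ′|⁻¹·1·|δ′|`). [cite: Jacobowitz1962, §4] [cite: Kottwitz1986BaseChangeUnits, §1 pp. 240–241] -/
theorem diagFixedPi_scaleLattice_le_dualLatt {σ : K →+* K} (hvσ : ∀ a, Valued.v (σ a) = Valued.v a) {d : Fin 3 → K} (hd1 : ∀ i, Valued.v (d i) ≤ 1)
    {δ : K} (hδ0 : δ ≠ 0) {M : Submodule 𝒪[K] (Fin 3 → K)} (hM : M ≤ scaleLattice δ⁻¹ (stdLattice K 3)) :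
    scaleLattice δ (stdLattice K 3) ≤ dualLatt σ (Matrix.diagonal d) M := by
  intro y hy
  rw [mem_dualLatt]
  intro x hx
  have hxi : ∀ i, Valued.v (x i) ≤ Valued.v δ⁻¹ := (mem_scaleLattice_stdLattice_iff (inv_ne_zero hδ0) x).1 (hM hx)
  have hyi : ∀ i, Valued.v (y i) ≤ Valued.v δ := (mem_scaleLattice_stdLattice_iff hδ0 y).1 hy
  have hvδ : Valued.v δ ≠ 0 := (Valuation.ne_zero_iff _).2 hδ0
  rw [pairing_apply]
  refine Valuation.map_sum_le _ (fun i _ => Valuation.map_sum_le _ (fun j _ => ?_))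
  by_cases hij : i = j
  · subst hij
    rw [Matrix.diagonal_apply_eq, map_mul, map_mul, hvσ]
    calc Valued.v (x i) * Valued.v (d i) * Valued.v (y i) ≤ Valued.v δ⁻¹ * 1 * Valued.v δ := mul_le_mul' (mul_le_mul' (hxi i) (hd1 i)) (hyi i)
      _ = 1 := by rw [mul_one, map_inv₀, inv_mul_cancel₀ hvδ]
  · rw [Matrix.diagonal_apply_ne _ hij, mul_zero, zero_mul, map_zero]
    exact zero_le

/-- **THE LOWER BOUND**: for a VERTEX lattice `M` of `diag(d)` (`|ϖ| ≤ |d_i| ≤ 1`, `ϖ ≠ 0`) with `M ≤ δ′⁻¹·L₀`: `ϖδ′·L₀ ≤ M` (★ `scaleLattice_dualLatt_le_of_isVertexLattice`).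
[cite: Kottwitz1986BaseChangeUnits, §1 pp. 240–241] [cite: BruhatTits1972, §10] -/
theorem diagFixedPi_scaleLattice_mul_le {σ : K →+* K} (hvσ : ∀ a, Valued.v (σ a) = Valued.v a) {ϖ : K} (hϖ0 : ϖ ≠ 0) {d : Fin 3 → K}
    (hd : ∀ i, Valued.v ϖ ≤ Valued.v (d i) ∧ Valued.v (d i) ≤ 1) {δ : K} (hδ0 : δ ≠ 0) {dd : ℕ} {M : Submodule 𝒪[K] (Fin 3 → K)}
    (hMv : IsVertexLattice σ ϖ (Matrix.diagonal d) dd M) (hM : M ≤ scaleLattice δ⁻¹ (stdLattice K 3)) :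
    scaleLattice (ϖ * δ) (stdLattice K 3) ≤ M := by
  calc scaleLattice (ϖ * δ) (stdLattice K 3) = scaleLattice ϖ (scaleLattice δ (stdLattice K 3)) := (scaleLattice_scaleLattice ϖ δ _).symm
    _ ≤ scaleLattice ϖ (dualLatt σ (Matrix.diagonal d) M) := scaleLattice_mono ϖ (diagFixedPi_scaleLattice_le_dualLatt hvσ (fun i => (hd i).2) hδ0 hM)
    _ ≤ M := scaleLattice_dualLatt_le_of_isVertexLattice hvσ (diagFixedPi_isUnit_det_diagonal hϖ0 hd) hMv

/-! ## §3 Every fixed vertex lies in the interval `[ϖ²δ·L₀, (ϖδ)⁻¹·L₀]`; finiteness -/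

/-- **A VERTEX FIXED BY A REGULAR DIAGONAL ELEMENT IS DEPTH-BOUNDED** (diagonal form with `|ϖ| ≤ |d_i| ≤ 1`): for `T = diag(s)` integral, `δ ≠ 0` with `|δ| ≤ |(s_i − s_j)(s_i − s_k)|`
for all orderings, and any VERTEX `M` of `latticeGraph σ ϖ (diag d)` with `T·M = M`: `ϖ²δ·L₀ ≤ M ≤ (ϖδ)⁻¹·L₀`. [cite: Kottwitz1986BaseChangeUnits, §1 pp. 240–241] [cite: Serre1980Trees, II.1.1]
[cite: BruhatTits1972, §10] -/
theorem diagFixedPi_interval {σ : K →+* K} (hvσ : ∀ a, Valued.v (σ a) = Valued.v a) {ϖ : K} (hϖ0 : ϖ ≠ 0) (hϖ1 : Valued.v ϖ ≤ 1) {d : Fin 3 → K}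
    (hd : ∀ i, Valued.v ϖ ≤ Valued.v (d i) ∧ Valued.v (d i) ≤ 1) {s : Fin 3 → K} (hs : ∀ l, Valued.v (s l) ≤ 1) {δ : K} (hδ0 : δ ≠ 0)
    (hδ : ∀ i j k : Fin 3, i ≠ j → i ≠ k → j ≠ k → Valued.v δ ≤ Valued.v ((s i - s j) * (s i - s k)))
    (T : GL (Fin 3) K) (hT : (T : Matrix (Fin 3) (Fin 3) K) = Matrix.diagonal s)
    {M : Submodule 𝒪[K] (Fin 3 → K)} (hM : IsVertex σ ϖ (Matrix.diagonal d) M) (hfix : mapGL T M = M) :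
    scaleLattice (ϖ * (ϖ * δ)) (stdLattice K 3) ≤ M ∧ M ≤ scaleLattice (ϖ * δ)⁻¹ (stdLattice K 3) := by
  obtain ⟨dd, hMv⟩ := hM
  have hSM : M.map ((Matrix.toLin' (Matrix.diagonal s)).restrictScalars 𝒪[K]) ≤ M := by
    rw [← hT]; exact hfix.le
  have hup := diagFixedPi_le_scaleLattice_inv hvσ hϖ0 hϖ1 hd hs hδ0 hδ hSM (le_dualLatt_of_isVertexLattice hvσ hMv)
  exact ⟨diagFixedPi_scaleLattice_mul_le hvσ hϖ0 hd (mul_ne_zero hϖ0 hδ0) hMv hup, hup⟩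

/-- The same for the vertices fixed by the graph automorphism of a UNITARY diagonal `T` (★ `latticeGraphIso`): the fixed set is contained in the interval.
[cite: Kottwitz1986BaseChangeUnits, §1 pp. 240–241] [cite: Serre1980Trees, II.1.1] -/
theorem diagFixedPi_setOf_latticeGraphIso_eq_subset_interval {σ : K →+* K} (hvσ : ∀ a, Valued.v (σ a) = Valued.v a) {ϖ : K} (hϖ0 : ϖ ≠ 0) (hϖ1 : Valued.v ϖ ≤ 1)
    {d : Fin 3 → K} (hd : ∀ i, Valued.v ϖ ≤ Valued.v (d i) ∧ Valued.v (d i) ≤ 1) {s : Fin 3 → K} (hs : ∀ l, Valued.v (s l) ≤ 1) {δ : K} (hδ0 : δ ≠ 0)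
    (hδ : ∀ i j k : Fin 3, i ≠ j → i ≠ k → j ≠ k → Valued.v δ ≤ Valued.v ((s i - s j) * (s i - s k)))
    (T : unitaryGroupOfForm σ (Matrix.diagonal d)) (hT : ((T : GL (Fin 3) K) : Matrix (Fin 3) (Fin 3) K) = Matrix.diagonal s) :
    {v : {M : Submodule 𝒪[K] (Fin 3 → K) // IsVertex σ ϖ (Matrix.diagonal d) M} | latticeGraphIso σ ϖ (Matrix.diagonal d) T v = v} ⊆
      {v | scaleLattice (ϖ * (ϖ * δ)) (stdLattice K 3) ≤ v.1 ∧ v.1 ≤ scaleLattice (ϖ * δ)⁻¹ (stdLattice K 3)} := by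
  intro v hv
  have hfix : mapGL (T : GL (Fin 3) K) v.1 = v.1 := by
    have h := congrArg Subtype.val hv
    exact h
  exact diagFixedPi_interval hvσ hϖ0 hϖ1 hd hs hδ0 hδ (T : GL (Fin 3) K) hT v.2 hfix

/-- **THE FIXED VERTEX SET OF A REGULAR DIAGONAL UNITARY ELEMENT IS FINITE — diagonal form with entries of valuation in `[|ϖ|, 1]`** (finite residue field): §3 puts it inside the
lattice interval `[ϖ²δ·L₀, (ϖδ)⁻¹·L₀]`, finite by ★ J4b `finite_of_forall_scaleLattice_le_and_le`.  ★ J4a `finite_setOf_latticeGraphIso_diagonal_eq` binder for binder with `hd`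
weakened from `|d_i| = 1` to `|ϖ| ≤ |d_i| ≤ 1` — the case of the Gram matrix `diag(−2ϖ, 1, 2ϖ)` of the eigenframe of Flicker's `t_ϖ`-literals. [cite: Kottwitz1986BaseChangeUnits, §1 pp. 240–241]
[cite: Serre1980Trees, II.1.1] -/
theorem diagFixedPi_finite_setOf_latticeGraphIso_diagonal_eq [Finite 𝓀[K]] {σ : K →+* K} (hvσ : ∀ a, Valued.v (σ a) = Valued.v a) {ϖ : K}
    (hϖ : Valued.v ϖ = WithZero.exp (-1 : ℤ)) {d : Fin 3 → K}
    (hd : ∀ i, Valued.v ϖ ≤ Valued.v (d i) ∧ Valued.v (d i) ≤ 1) {s : Fin 3 → K} (hs : ∀ l, Valued.v (s l) ≤ 1) {δ : K} (hδ0 : δ ≠ 0)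
    (hδ : ∀ i j k : Fin 3, i ≠ j → i ≠ k → j ≠ k → Valued.v δ ≤ Valued.v ((s i - s j) * (s i - s k)))
    (T : unitaryGroupOfForm σ (Matrix.diagonal d)) (hT : ((T : GL (Fin 3) K) : Matrix (Fin 3) (Fin 3) K) = Matrix.diagonal s) :
    {v : {M : Submodule 𝒪[K] (Fin 3 → K) // IsVertex σ ϖ (Matrix.diagonal d) M} | latticeGraphIso σ ϖ (Matrix.diagonal d) T v = v}.Finite := by
  have hϖ0 : ϖ ≠ 0 := by
    intro h; rw [h, map_zero] at hϖ; exact WithZero.coe_ne_zero hϖ.symm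
  have hϖ1 : Valued.v ϖ ≤ 1 := by rw [hϖ, ← WithZero.exp_zero]; exact WithZero.exp_le_exp.2 (by norm_num)
  -- `|δ| ≤ 1`, hence `|ϖ²δ| ≤ 1 ≤ |(ϖδ)⁻¹|`
  have hδ1 : Valued.v δ ≤ 1 := by
    refine (hδ 0 1 2 (by decide) (by decide) (by decide)).trans ?_
    rw [map_mul]
    exact mul_le_one' ((Valuation.map_sub _ _ _).trans (max_le (hs 0) (hs 1))) ((Valuation.map_sub _ _ _).trans (max_le (hs 0) (hs 2)))
  have hϖδ1 : Valued.v (ϖ * δ) ≤ 1 := by rw [map_mul]; exact mul_le_one' hϖ1 hδ1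
  have hab : Valued.v (ϖ * (ϖ * δ)) ≤ Valued.v (ϖ * δ)⁻¹ := by
    rw [map_mul, map_inv₀]
    calc Valued.v ϖ * Valued.v (ϖ * δ) ≤ 1 * 1 := mul_le_mul' hϖ1 hϖδ1
      _ = 1 := one_mul 1
      _ ≤ (Valued.v (ϖ * δ))⁻¹ := one_le_inv_iff₀.2 ⟨(Valuation.pos_iff _).2 (mul_ne_zero hϖ0 hδ0), hϖδ1⟩
  have himage : (Subtype.val '' {v : {M : Submodule 𝒪[K] (Fin 3 → K) // IsVertex σ ϖ (Matrix.diagonal d) M} |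
      latticeGraphIso σ ϖ (Matrix.diagonal d) T v = v}).Finite := by
    refine finite_of_forall_scaleLattice_le_and_le hϖ (mul_ne_zero hϖ0 (mul_ne_zero hϖ0 hδ0)) hab (fun M hM => ?_)
    obtain ⟨v, hv, rfl⟩ := hM
    exact diagFixedPi_setOf_latticeGraphIso_eq_subset_interval hvσ hϖ0 hϖ1 hd hs hδ0 hδ T hT hv
  exact Set.Finite.of_finite_image himage Subtype.val_injective.injOn

end Summit.HodgeConjecture.HodgeConjecture.R90.S6

end
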